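import Summits.HodgeConjecture.CorCM.MultiFieldWeilTwoTransitiveTowerCoprime
import HarnessLib

/-!
# MULTI-FIELD WEIL ENGINE — THE MIXED TOWER: each field is peeled EITHER by a prime rotation (prime relative degree, larger than every live field — nothing else) OR by
# design separation (moved 2-transitively by automorphisms of `ℂ/k` fixing the live fields), over one-member fields of pairwise coprime degrees; one theorem to cite

Cell `pub-hodgecm2` (COR-CM), seat b30 gen 30 (2026-08-24); count-neutral own lane MULTI-FIELD WEIL ENGINE (stem `MultiFieldWeil*`), the common roof of
`CorCM/MultiFieldWeilPrimeTower.lean` (prime rotations) and `CorCM/MultiFieldWeilTwoTransitiveTower{,Coprime}.lean` (design separation).  Theorems only; no definition,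
no named fact of its own, no `sorry`.  HONEST FRAMING: the general headline is CONDITIONAL on the displayed single-slot Weil spaces; the Markman form is conditional ONLY
on Markman's fourfold and hyperbolic-sixfold theorems.  `HC_CM` is NOT proved and not asserted.

THE STATEMENT.  Fields `K_m ⊇ i_m(k)` split into a low set `L` (ONE member over `τ`, pairwise coprime relative degrees — nothing else) and a tower taken in index order; a
tower field `K_{m₀}` is admissible if EITHER (a) its relative degree `n_{m₀}` is PRIME and exceeds the degree of every live field (the fields of `L` and the earlier tower
fields) — then a pure realised `n_{m₀}`-cycle exists for free (Cauchy + power trick) and cyclotomy separates — OR (b) every two pairs of its distinct `τ`-embeddings are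
interchanged by an automorphism of `ℂ/τ(k)` FIXING all `τ`-embeddings of the live fields (design separation).  Then every balanced configuration obeys the defect law
(**`exists_hasDefectsG_realisedTuples_of_mixedTower`**), and the Hodge conjecture holds for every product of copies of `E` and the `B_m` GIVEN the single-slot Weil
spaces (**`hodgeConjectureFor_biproduct_comp_of_mixedTower_intrinsic`**); with `(n_m, p_m) ∈ {(3,1), (4,1), (4,2), (5,2)}` GIVEN ONLY Markman's theorems
(**`…_mixedTower_markman`**): e.g. ordering by degree, the FIRST sextic and the FIRST decic field are free, octic fields and repeated degrees need (b).
[cite: DixonMortimer1996, §1.6 and §2.1] [cite: MoonenZarhin1995Duke, Thm. 2.4] [cite: Shimura1998, §18.2 Lemma (i)] [cite: Pohlmann1968, Thm 1]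
[cite: Markman2025SurveySecant, Thm. 1.2] [cite: Markman2025SecantWeil, Thm 1.5.1] [cite: MumfordAV1970, §19]

## References
* [DixonMortimer1996] J. D. Dixon, B. Mortimer, *Permutation Groups*, GTM 163, §1.6, §2.1.  [MoonenZarhin1995Duke] B. Moonen, Yu. Zarhin, Duke Math. J. 77 (1995),
  Thm. 2.4.  [Shimura1998] G. Shimura, *Abelian varieties with CM and modular functions*, §18.2 Lemma (i).  [Pohlmann1968] H. Pohlmann, Ann. of Math. 88 (1968),
  Thm 1.  [Markman2025SurveySecant] E. Markman, arXiv:2509.23403, Thm. 1.2.  [Markman2025SecantWeil] E. Markman, Cycles on abelian 2n-folds of Weil type from secant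
  sheaves on abelian n-folds, Thm 1.5.1.  [MumfordAV1970] D. Mumford, *Abelian Varieties*, §19.
-/

noncomputable section

open CategoryTheory CategoryTheory.Limits NumberField

namespace Summit.HodgeConjecture.CorCM.MultiFieldWeil

open Finset
open Literature.AlgebraicGeometry Literature.AlgebraicGeometry.Motives Literature.AlgebraicGeometry.HodgeTheory
open Literature.AlgebraicGeometry.ComplexMultiplication (IsCMTypeRealisation)
open Literature.AlgebraicTopology.SingularHomology
open Literature.NumberTheory.ComplexMultiplication
open Summit.HodgeConjecture.CorCM.Census.MultiFieldWeil

open scoped Classical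

/-! ## §1 Abstract: each tower slot peeled by a pure prime rotation OR by a 2-transitive pure set -/

section Tower

variable {r : ℕ} {n : Fin r → ℕ} {R : Finset (PermsG n)} {P : ∀ m : Fin r, Finset (Fin (n m))}

/-- **PEELING A MIXED TOWER.**  `R` closed under products and inverses, non-empty; tower slots (outside `L`) with proper non-empty position sets and pairwise distinct
priorities; for each tower slot `m₀`, EITHER `n m₀` is prime and `R` contains a tuple pure on the live slots (those of `L` and the tower slots of lower priority) whose
`m₀`-component has order `n m₀`, OR the tuples of `R` pure on the live slots act 2-transitively on the slot.  Then every tower slot has constant defect.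
[cite: DixonMortimer1996, §1.6 and §2.1] [cite: MoonenZarhin1995Duke, Thm. 2.4] -/
theorem const_of_signed_mixedTower (hmul : ∀ π ∈ R, ∀ π' ∈ R, π * π' ∈ R) (hinv : ∀ π ∈ R, π⁻¹ ∈ R) (hne : R.Nonempty)
    (L : Finset (Fin r)) (prio : Fin r → ℕ) (hinj : ∀ m m', m ∉ L → m' ∉ L → prio m = prio m' → m = m')
    (hP0 : ∀ m, m ∉ L → (P m).Nonempty) (hPn : ∀ m, m ∉ L → (P m).card < n m)
    (hmix : ∀ m₀, m₀ ∉ L →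
      ((n m₀).Prime ∧ ∃ ρ ∈ R, (∀ m ∈ L, ρ m = 1) ∧ (∀ m, m ∉ L → prio m < prio m₀ → ρ m = 1) ∧ orderOf (ρ m₀) = n m₀) ∨
      (∀ a b a' b' : Fin (n m₀), a ≠ b → a' ≠ b' →
        ∃ ρ ∈ R, (∀ m ∈ L, ρ m = 1) ∧ (∀ m, m ∉ L → prio m < prio m₀ → ρ m = 1) ∧ ρ m₀ a = a' ∧ ρ m₀ b = b'))
    {u : ℤ} {d : ∀ m : Fin r, Fin (n m) → ℤ}
    (h : ∀ π ∈ R, u + ∑ m : Fin r, ∑ a : Fin (n m), (if π m a ∈ P m then d m a else -d m a) = 0) :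
    ∀ m, m ∉ L → ∀ a b : Fin (n m), d m a = d m b := by
  obtain ⟨π₀, hπ₀⟩ := hne
  suffices H : ∀ (N : ℕ) (m : Fin r), m ∉ L → univ.sup prio - prio m < N → ∀ a b : Fin (n m), d m a = d m b from
    fun m hm => H _ m hm (Nat.lt_succ_self _)
  intro N
  induction N with
  | zero => exact fun m _ hN => absurd hN (Nat.not_lt_zero _)
  | succ N ih =>
    intro m hm hN
    set M : Finset (Fin r) := univ.filter fun m' => m' ∈ L ∨ (m' ∉ L ∧ prio m' < prio m) with hM
    have hout : ∀ m', m' ∉ M → m' ≠ m → ∀ a b : Fin (n m'), d m' a = d m' b := by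
      intro m' hm'M hm'm
      have hm'L : m' ∉ L := fun hL => hm'M (by rw [hM]; exact Finset.mem_filter.2 ⟨Finset.mem_univ _, Or.inl hL⟩)
      have h1 : ¬ prio m' < prio m := fun hlt =>
        hm'M (by rw [hM]; exact Finset.mem_filter.2 ⟨Finset.mem_univ _, Or.inr ⟨hm'L, hlt⟩⟩)
      have h2' : prio m' ≠ prio m := fun heq => hm'm (hinj m' m hm'L hm heq)
      have h3 : prio m' ≤ univ.sup prio := Finset.le_sup (f := prio) (Finset.mem_univ m')
      exact ih m' hm'L (by omega)
    have hmemM : ∀ {ρ : PermsG n}, (∀ m' ∈ L, ρ m' = 1) → (∀ m', m' ∉ L → prio m' < prio m → ρ m' = 1) → ∀ m' ∈ M, ρ m' = 1 := by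
      intro ρ hρL hρlt m' hm'
      rw [hM] at hm'
      rcases (Finset.mem_filter.1 hm').2 with hL | ⟨hL, hlt⟩
      · exact hρL m' hL
      · exact hρlt m' hL hlt
    rcases hmix m hm with ⟨hpr, ρ, hρ, hρL, hρlt, hord⟩ | h2
    · -- (a) a pure prime rotation
      obtain ⟨g, hg⟩ := exists_conj_finRotate_of_orderOf_eq_prime hpr (ρ m) hord
      refine const_of_signed_pure_on hmul M hρ (hmemM hρL hρlt) hπ₀ (fun f hf => ?_) hout h
      exact sep_of_conj_rotate_prime hpr (π₀ m) g (hP0 m hm) (hPn m hm) f (fun j => by rw [hg]; exact hf j)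
    · -- (b) a 2-transitive set of pure tuples
      set H : Finset (PermsG n) := R.filter fun ρ => ∀ m' ∈ M, ρ m' = 1 with hH
      have hHR : ∀ ρ ∈ H, ρ ∈ R ∧ ∀ m' ∈ M, ρ m' = 1 := fun ρ hρ => by
        rw [hH] at hρ
        exact Finset.mem_filter.1 hρ
      have hmulH : ∀ ρ ∈ H, ∀ ρ' ∈ H, ρ * ρ' ∈ H := fun ρ hρ ρ' hρ' => by
        obtain ⟨hρR, hρM⟩ := hHR ρ hρ
        obtain ⟨hρ'R, hρ'M⟩ := hHR ρ' hρ'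
        rw [hH]
        exact Finset.mem_filter.2 ⟨hmul ρ hρR ρ' hρ'R, fun m' hm' => by rw [Pi.mul_apply, hρM m' hm', hρ'M m' hm', mul_one]⟩
      have hinvH : ∀ ρ ∈ H, ρ⁻¹ ∈ H := fun ρ hρ => by
        obtain ⟨hρR, hρM⟩ := hHR ρ hρ
        rw [hH]
        exact Finset.mem_filter.2 ⟨hinv ρ hρR, fun m' hm' => by rw [Pi.inv_apply, hρM m' hm', inv_one]⟩
      have h2H : ∀ a b a' b' : Fin (n m), a ≠ b → a' ≠ b' → ∃ ρ ∈ H, ρ m a = a' ∧ ρ m b = b' := by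
        intro a b a' b' hab hab'
        obtain ⟨ρ, hρ, hρL, hρlt, hρa, hρb⟩ := h2 a b a' b' hab hab'
        refine ⟨ρ, ?_, hρa, hρb⟩
        rw [hH]
        exact Finset.mem_filter.2 ⟨hρ, hmemM hρL hρlt⟩
      refine const_of_signed_pureSet_on hmul M H hHR hπ₀ (fun f hf => ?_) hout h
      exact sep_of_twoTransitive_translates hmulH hinvH h2H (π₀ m) (hP0 m hm) (hPn m hm) f hf

/-- **THE MIXED TOWER OVER COPRIME ORBITS**: with the orbits of the slots of `L` of pairwise coprime sizes and separating, EVERY slot has constant defect.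
[cite: DixonMortimer1996, §1.6 and §2.1] -/
theorem const_of_signed_mixedTower_coprime (hmul : ∀ π ∈ R, ∀ π' ∈ R, π * π' ∈ R) (hinv : ∀ π ∈ R, π⁻¹ ∈ R) (hne : R.Nonempty)
    (L : Finset (Fin r)) (prio : Fin r → ℕ) (hinj : ∀ m m', m ∉ L → m' ∉ L → prio m = prio m' → m = m')
    (hP0 : ∀ m, m ∉ L → (P m).Nonempty) (hPn : ∀ m, m ∉ L → (P m).card < n m)
    (hmix : ∀ m₀, m₀ ∉ L →
      ((n m₀).Prime ∧ ∃ ρ ∈ R, (∀ m ∈ L, ρ m = 1) ∧ (∀ m, m ∉ L → prio m < prio m₀ → ρ m = 1) ∧ orderOf (ρ m₀) = n m₀) ∨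
      (∀ a b a' b' : Fin (n m₀), a ≠ b → a' ≠ b' →
        ∃ ρ ∈ R, (∀ m ∈ L, ρ m = 1) ∧ (∀ m, m ∉ L → prio m < prio m₀ → ρ m = 1) ∧ ρ m₀ a = a' ∧ ρ m₀ b = b'))
    (hcop : ∀ m ∈ L, ∀ m' ∈ L, m ≠ m' → ((orbitG R P m).card).Coprime ((orbitG R P m').card))
    (hsep : ∀ m ∈ L, ∀ f : Fin (n m) → ℤ, (∀ Q ∈ orbitG R P m, ∑ a ∈ Q, f a = ∑ a ∈ P m, f a) → ∀ a b : Fin (n m), f a = f b)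
    {u : ℤ} {d : ∀ m : Fin r, Fin (n m) → ℤ}
    (h : ∀ π ∈ R, u + ∑ m : Fin r, ∑ a : Fin (n m), (if π m a ∈ P m then d m a else -d m a) = 0) :
    ∀ (m : Fin r) (a b : Fin (n m)), d m a = d m b := by
  have htop := const_of_signed_mixedTower hmul hinv hne L prio hinj hP0 hPn hmix h
  have hlow : ∀ m ∈ L, ∀ a b : Fin (n m), d m a = d m b :=
    const_of_signed_jointSetTransitive_on (R := R) (P := P) (𝒳 := orbitG R P) L (fun m _ => self_mem_orbitG (one_mem_of_closed hmul hinv hne) m)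
      (fun Q hQ => exists_forall_mem_of_coprime_on hmul hinv hne L hcop Q hQ) hsep (fun m hm => htop m hm) h
  intro m
  by_cases hm : m ∈ L
  · exact hlow m hm
  · exact htop m hm

end Tower

/-! ## §2 The defect law -/

section Realised

variable {I : Type} {r : ℕ} {Kf : I → Type} [∀ i, Field (Kf i)] [∀ i, NumberField (Kf i)] {i₀ : I} {is : Fin r → I} {n : Fin r → ℕ}
  {e : ∀ m : Fin r, (Kf (is m) →+* ℂ) ≃ Fin (n m) × Bool} {τ : Kf i₀ →+* ℂ} {im : ∀ m : Fin r, Kf i₀ →+* Kf (is m)}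
  (he_sign : ∀ (m : Fin r) (s : Kf (is m) →+* ℂ), (e m s).2 = true ↔ s.comp (im m) = τ)

include he_sign in
/-- **THE DEFECT LAW — MIXED TOWER OVER ONE-MEMBER FIELDS OF PAIRWISE COPRIME DEGREES.**  `L`: one member over `τ`, pairwise coprime `n_m`.  Tower (index order, `0 < |P m| <
n m`): each `K_{m₀}` EITHER has PRIME `n_{m₀}` larger than every live degree (fields of `L` and earlier tower fields) — nothing else — OR is moved 2-transitively on its
`τ`-embeddings by automorphisms of `ℂ/τ(k)` FIXING the `τ`-embeddings of the live fields (`hmix`).  Every configuration balanced under the realised tuples obeys the defect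
law with any `c m = n m − 2|P m|` (as integers). [cite: MoonenZarhin1995Duke, Thm. 2.4] [cite: DixonMortimer1996, §1.6 and §2.1] [cite: Shimura1998, §18.2 Lemma (i)] -/
theorem exists_hasDefectsG_realisedTuples_of_mixedTower (L : Finset (Fin r))
    (hcop : ∀ m ∈ L, ∀ m' ∈ L, m ≠ m' → (n m).Coprime (n m'))
    {P : ∀ m : Fin r, Finset (Fin (n m))} (hP1 : ∀ m ∈ L, ∃ p : Fin (n m), P m = {p})
    (hP0 : ∀ m, m ∉ L → (P m).Nonempty) (hPn : ∀ m, m ∉ L → (P m).card < n m)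
    (hmix : ∀ m₀, m₀ ∉ L →
      ((n m₀).Prime ∧ ∀ m : Fin r, (m ∈ L ∨ (m ∉ L ∧ m < m₀)) → n m < n m₀) ∨
      (∀ s t s' t' : Kf (is m₀) →+* ℂ, s.comp (im m₀) = τ → t.comp (im m₀) = τ → s'.comp (im m₀) = τ → t'.comp (im m₀) = τ → s ≠ t → s' ≠ t' →
        ∃ ρ : ℂ ≃+* ℂ, (∀ m : Fin r, (m ∈ L ∨ (m ∉ L ∧ m < m₀)) → ∀ u : Kf (is m) →+* ℂ, u.comp (im m) = τ → (ρ : ℂ →+* ℂ).comp u = u) ∧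
          (ρ : ℂ →+* ℂ).comp s = s' ∧ (ρ : ℂ →+* ℂ).comp t = t'))
    (c : Fin r → ℕ) (hc : ∀ m, ((c m : ℕ) : ℤ) = (n m : ℤ) - 2 * (P m).card)
    {α : Type} (v : α → PtG n) (T : Finset α) (hT : ModelBalancedG P (realisedTuples e τ) v T) :
    ∃ t : Fin r → ℤ, HasDefectsG c v T t := by
  have hmul : ∀ π ∈ realisedTuples e τ, ∀ π' ∈ realisedTuples e τ, π * π' ∈ realisedTuples e τ :=
    fun π hπ π' hπ' => mul_mem_realisedTuples e τ hπ hπ'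
  have hinv : ∀ π ∈ realisedTuples e τ, π⁻¹ ∈ realisedTuples e τ := fun π hπ => inv_mem_realisedTuples hπ
  have hne : (realisedTuples e τ).Nonempty := realisedTuples_nonempty (e := e) he_sign
  have htrans : ∀ (m : Fin r) (a b : Fin (n m)), ∃ π ∈ realisedTuples e τ, π m a = b := fun m a b =>
    transitive_realisedTuples (e := e) he_sign m a b
  have hconst := const_of_signed_mixedTower_coprime (P := P) hmul hinv hne L (fun m => (m : ℕ)) (fun m m' _ _ h => Fin.ext h) hP0 hPn
    (fun m₀ hm₀ => by
      rcases hmix m₀ hm₀ with ⟨hpr, hlt⟩ | h2T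
      · -- (a) a realised pure rotation: every live slot is smaller
        left
        refine ⟨hpr, ?_⟩
        obtain ⟨ρ, hρ, hρM, hord⟩ := exists_pure_on_mem_realisedTuples (e := e) he_sign m₀ hpr
          (univ.filter fun m => m ∈ L ∨ (m ∉ L ∧ m < m₀)) fun m hm => hlt m (Finset.mem_filter.1 hm).2
        exact ⟨ρ, hρ, fun m hm => hρM m (Finset.mem_filter.2 ⟨Finset.mem_univ _, Or.inl hm⟩),
          fun m hmL hlt' => hρM m (Finset.mem_filter.2 ⟨Finset.mem_univ _, Or.inr ⟨hmL, hlt'⟩⟩), hord⟩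
      · -- (b) relative 2-transitivity
        right
        intro a b a' b' hab hab'
        obtain ⟨π, hπ, hπS, hπa, hπb⟩ := twoTransitiveRel_realisedTuples (e := e) he_sign (univ.filter fun m => m ∈ L ∨ (m ∉ L ∧ m < m₀)) m₀
          (fun s t s' t' hs ht hs' ht' hst hst' => by
            obtain ⟨ρ, hfix, hρs, hρt⟩ := h2T s t s' t' hs ht hs' ht' hst hst'
            exact ⟨ρ, fun m hm u hu => hfix m (Finset.mem_filter.1 hm).2 u hu, hρs, hρt⟩) hab hab'
        exact ⟨π, hπ, fun m hm => hπS m (Finset.mem_filter.2 ⟨Finset.mem_univ _, Or.inl hm⟩),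
          fun m hmL hlt => hπS m (Finset.mem_filter.2 ⟨Finset.mem_univ _, Or.inr ⟨hmL, hlt⟩⟩), hπa, hπb⟩)
    (fun m hm m' hm' hmm' => by
      obtain ⟨p, hp⟩ := hP1 m hm
      obtain ⟨p', hp'⟩ := hP1 m' hm'
      rw [card_orbitG_singleton hp (htrans m), card_orbitG_singleton hp' (htrans m')]
      exact hcop m hm m' hm' hmm')
    (fun m hm f hf => by
      obtain ⟨p, hp⟩ := hP1 m hm
      exact sep_of_singletons (fun a => singleton_mem_orbitG hp (htrans m) a) f hf)
    fun π hπ => signed_of_modelBalancedG (realisedTuples e τ) v hT hπ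
  obtain ⟨t, hd, he'⟩ := exists_defects_of_const (P := P) hne hconst fun π hπ => signed_of_modelBalancedG (realisedTuples e τ) v hT hπ
  refine ⟨t, fun m a => hd m a, ?_⟩
  rw [he']
  exact Finset.sum_congr rfl fun m _ => by rw [hc m]

end Realised

/-! ## §3 The headlines -/

section Headline

variable {I : Type} {r : ℕ} {Kf : I → Type} [∀ i, Field (Kf i)] [∀ i, NumberField (Kf i)] [∀ i, IsCMField (Kf i)]
  {i₀ : I} {is : Fin r → I} {n : Fin r → ℕ} {τ : Kf i₀ →+* ℂ}
  {A : Fin (r + 1) → AbelianVariety ℂ} {Φ : ∀ j : Fin (r + 1), CMType (Kf (mfSlots i₀ is j))}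
  {ι : ∀ j, 𝓞 (Kf (mfSlots i₀ is j)) →+* End (A j)}
  {θ : ∀ j, Kf (mfSlots i₀ is j) →+* Module.End ℂ (complexBetti (A j).X 1)}

/-- **HEADLINE — THE MIXED TOWER (intrinsic form).**  `E = A 0 ⊨ (k; {τ})`, `B_m = A (m+1) ⊨ (K_m; Φ (m+1))`, `[K_m : ℚ] = 2 n_m`, `p_m` members over `τ` (`0 < p_m`,
`2p_m ≤ n_m`).  Low set `L`: `p_m = 1`, pairwise coprime `n_m`.  Tower (index order): each `K_{m₀}` EITHER of PRIME relative degree exceeding every live degree, OR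
relatively 2-transitive (`hmix`).  Then the Hodge conjecture holds for EVERY product of copies `⨁_j A(κ j)` GIVEN the single-slot Weil spaces `hW m`.  `HC_CM` is NOT asserted.
[cite: Pohlmann1968, Thm 1] [cite: MoonenZarhin1995Duke, Thm. 2.4] [cite: DixonMortimer1996, §1.6 and §2.1] [cite: Shimura1998, §18.2 Lemma (i)] -/
theorem hodgeConjectureFor_biproduct_comp_of_mixedTower_intrinsic (p : Fin r → ℕ) (L : Finset (Fin r))
    (hcop : ∀ m ∈ L, ∀ m' ∈ L, m ≠ m' → (n m).Coprime (n m')) (hp1 : ∀ m ∈ L, p m = 1) (hp0 : ∀ m, 0 < p m) (hpn : ∀ m, 2 * p m ≤ n m)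
    {N : ℕ} (κ : Fin N → Fin (r + 1)) (h2 : Module.finrank ℚ (Kf i₀) = 2) (hdeg : ∀ m : Fin r, Module.finrank ℚ (Kf (is m)) = 2 * n m)
    (im : ∀ m : Fin r, Kf i₀ →+* Kf (is m))
    (hmix : ∀ m₀, m₀ ∉ L →
      ((n m₀).Prime ∧ ∀ m : Fin r, (m ∈ L ∨ (m ∉ L ∧ m < m₀)) → n m < n m₀) ∨
      (∀ s t s' t' : Kf (is m₀) →+* ℂ, s.comp (im m₀) = τ → t.comp (im m₀) = τ → s'.comp (im m₀) = τ → t'.comp (im m₀) = τ → s ≠ t → s' ≠ t' →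
        ∃ ρ : ℂ ≃+* ℂ, (∀ m : Fin r, (m ∈ L ∨ (m ∉ L ∧ m < m₀)) → ∀ u : Kf (is m) →+* ℂ, u.comp (im m) = τ → (ρ : ℂ →+* ℂ).comp u = u) ∧
          (ρ : ℂ →+* ℂ).comp s = s' ∧ (ρ : ℂ →+* ℂ).comp t = t'))
    {δ : 𝓞 (Kf i₀)} {d : ℕ} (hτ : τ (δ : Kf i₀) = Complex.I * (Real.sqrt d : ℂ))
    (hA : ∀ j, IsCMTypeRealisation (Φ j) (A j) (ι j) (θ j))
    (hΨ : ∀ σ : Kf i₀ →+* ℂ, σ ∈ (Φ 0).1 ↔ σ = τ)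
    (hp : ∀ m : Fin r, (Finset.univ.filter fun s : Kf (is m) →+* ℂ => s.comp (im m) = τ ∧ s ∈ (Φ m.succ).1).card = p m)
    (hW : ∀ m : Fin r, weilClassesOf (⨁ fun i => A (partSlots (n m - 2 * p m) m i))
      (biproduct.map fun i => ι (partSlots (n m - 2 * p m) m i) (δfam im δ (partSlots (n m - 2 * p m) m i))) (n m - p m) d ≤
      algebraicClasses (⨁ fun i => A (partSlots (n m - 2 * p m) m i)).X (n m - p m)) :
    HodgeConjectureFor (⨁ fun j => A (κ j)).dim (⨁ fun j => A (κ j)).X := by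
  have hττ : ComplexEmbedding.conjugate τ ≠ τ := QuarticCM.conjugate_ne τ
  have hk : ∀ σ : Kf i₀ →+* ℂ, σ = τ ∨ σ = ComplexEmbedding.conjugate τ := fun σ => QuarticCM.eq_or_eq_conjugate_of_quadratic h2 τ σ
  have hfr : ∀ m : Fin r, ∃ e : (Kf (is m) →+* ℂ) ≃ Fin (n m) × Bool, (∀ s, (e s).2 = true ↔ s.comp (im m) = τ) ∧
      ∀ s, e (ComplexEmbedding.conjugate s) = ((e s).1, !(e s).2) := fun m => exists_signFrame (hdeg m) h2 (im m) hττ hk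
  choose e he_sign he_conj using hfr
  let P : ∀ m : Fin r, Finset (Fin (n m)) := fun m => Finset.univ.filter fun a : Fin (n m) => (e m).symm (a, true) ∈ (Φ m.succ).1
  have hcard : ∀ m, (P m).card = p m := fun m => (card_posSet (he_sign m) (Φ m.succ)).trans (hp m)
  exact hodgeConjectureFor_biproduct_comp_of_defectLawG (is := is) P (fun m => n m - 2 * p m) (fun m => n m - p m)
    (fun m => by have := hpn m; omega) (fun m => by have := hp0 m; have := hpn m; omega) κ h2 im hτ hA e he_sign he_conj hΨ
    (fun m s => mem_iff_snd_eq_decide_mem_posSet (he_conj m) (Φ m.succ) s)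
    (fun v T hT => exists_hasDefectsG_realisedTuples_of_mixedTower (e := e) he_sign L hcop
      (fun m hm => Finset.card_eq_one.1 (by rw [hcard m, hp1 m hm]))
      (fun m _ => Finset.card_pos.1 (by rw [hcard m]; exact hp0 m)) (fun m _ => by have := hpn m; have := hp0 m; rw [hcard m]; omega) hmix
      (fun m => n m - 2 * p m) (fun m => by rw [hcard m, Nat.cast_sub (hpn m)]; push_cast; ring) v T hT) hW

/-- **HEADLINE — THE MIXED TOWER WITH SEXTIC / OCTIC / DECIC FIELDS, GIVEN ONLY MARKMAN'S TWO THEOREMS.**  `(n_m, p_m) ∈ {(3,1), (4,1), (4,2), (5,2)}`; low set `L`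
(`p_m = 1`, pairwise coprime `n_m`); tower fields admissible by (a) prime degree above every live degree (free — e.g., ordering by degree, the FIRST sextic and the FIRST
decic field) or (b) relative 2-transitivity.  HC of EVERY product of copies of `E` and the `B_m`.  `HC_CM` is NOT asserted. [cite: Markman2025SurveySecant, Thm. 1.2]
[cite: Markman2025SecantWeil, Thm 1.5.1] [cite: Pohlmann1968, Thm 1] [cite: DixonMortimer1996, §1.6 and §2.1] -/
theorem hodgeConjectureFor_biproduct_comp_of_mixedTower_markman (hW4 : Markman2025_weilClasses_algebraic_abelianFourfold)
    (hM6 : Markman2025_weilClasses_algebraic_hyperbolicSixfold) (n p : Fin r → ℕ) (L : Finset (Fin r))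
    (hnp : ∀ m, (n m = 3 ∧ p m = 1) ∨ (n m = 4 ∧ p m = 1) ∨ (n m = 4 ∧ p m = 2) ∨ (n m = 5 ∧ p m = 2))
    (hcop : ∀ m ∈ L, ∀ m' ∈ L, m ≠ m' → (n m).Coprime (n m')) (hp1 : ∀ m ∈ L, p m = 1)
    {N : ℕ} (κ : Fin N → Fin (r + 1)) (h2 : Module.finrank ℚ (Kf i₀) = 2) (hdeg : ∀ m : Fin r, Module.finrank ℚ (Kf (is m)) = 2 * n m)
    (im : ∀ m : Fin r, Kf i₀ →+* Kf (is m)) (hA : ∀ j, IsCMTypeRealisation (Φ j) (A j) (ι j) (θ j)) (hΨ : ∀ σ : Kf i₀ →+* ℂ, σ ∈ (Φ 0).1 ↔ σ = τ)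
    (hp : ∀ m : Fin r, (Finset.univ.filter fun s : Kf (is m) →+* ℂ => s.comp (im m) = τ ∧ s ∈ (Φ m.succ).1).card = p m)
    (hmix : ∀ m₀, m₀ ∉ L →
      ((n m₀).Prime ∧ ∀ m : Fin r, (m ∈ L ∨ (m ∉ L ∧ m < m₀)) → n m < n m₀) ∨
      (∀ s t s' t' : Kf (is m₀) →+* ℂ, s.comp (im m₀) = τ → t.comp (im m₀) = τ → s'.comp (im m₀) = τ → t'.comp (im m₀) = τ → s ≠ t → s' ≠ t' →
        ∃ ρ : ℂ ≃+* ℂ, (∀ m : Fin r, (m ∈ L ∨ (m ∉ L ∧ m < m₀)) → ∀ u : Kf (is m) →+* ℂ, u.comp (im m) = τ → (ρ : ℂ →+* ℂ).comp u = u) ∧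
          (ρ : ℂ →+* ℂ).comp s = s' ∧ (ρ : ℂ →+* ℂ).comp t = t')) :
    HodgeConjectureFor (⨁ fun j => A (κ j)).dim (⨁ fun j => A (κ j)).X := by
  obtain ⟨δ₀, d, hd, hδ₀⟩ := CyclicSextic.exists_sq_eq_neg_nat_of_isTotallyComplex (Kf i₀) h2
  obtain ⟨δ, hδ, hτ⟩ := OcticCurveFourfold.exists_delta_of_mem h2 hd hδ₀ τ
  refine hodgeConjectureFor_biproduct_comp_of_mixedTower_intrinsic (is := is) (n := n) p L hcop hp1 (fun m => ?_) (fun m => ?_) κ h2 hdeg im hmix hτ hA hΨ hp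
    fun m => weilHyp_of_markman_intrinsic hW4 hM6 m (hnp m) (hdeg m) h2 hd hδ hA hΨ (hp m)
  · rcases hnp m with ⟨-, h⟩ | ⟨-, h⟩ | ⟨-, h⟩ | ⟨-, h⟩ <;> omega
  · rcases hnp m with ⟨h, h'⟩ | ⟨h, h'⟩ | ⟨h, h'⟩ | ⟨h, h'⟩ <;> omega

/-- **… and for every abelian variety DOMINATED by such a product.** `HC_CM` is NOT asserted. [cite: MumfordAV1970, §19] [cite: Markman2025SurveySecant, Thm. 1.2]
[cite: Markman2025SecantWeil, Thm 1.5.1] -/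
theorem hodgeConjectureFor_of_avDominatedBy_comp_of_mixedTower_markman (hW4 : Markman2025_weilClasses_algebraic_abelianFourfold)
    (hM6 : Markman2025_weilClasses_algebraic_hyperbolicSixfold) (n p : Fin r → ℕ) (L : Finset (Fin r))
    (hnp : ∀ m, (n m = 3 ∧ p m = 1) ∨ (n m = 4 ∧ p m = 1) ∨ (n m = 4 ∧ p m = 2) ∨ (n m = 5 ∧ p m = 2))
    (hcop : ∀ m ∈ L, ∀ m' ∈ L, m ≠ m' → (n m).Coprime (n m')) (hp1 : ∀ m ∈ L, p m = 1)
    {N : ℕ} (κ : Fin N → Fin (r + 1)) (h2 : Module.finrank ℚ (Kf i₀) = 2) (hdeg : ∀ m : Fin r, Module.finrank ℚ (Kf (is m)) = 2 * n m)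
    (im : ∀ m : Fin r, Kf i₀ →+* Kf (is m)) (hA : ∀ j, IsCMTypeRealisation (Φ j) (A j) (ι j) (θ j)) (hΨ : ∀ σ : Kf i₀ →+* ℂ, σ ∈ (Φ 0).1 ↔ σ = τ)
    (hp : ∀ m : Fin r, (Finset.univ.filter fun s : Kf (is m) →+* ℂ => s.comp (im m) = τ ∧ s ∈ (Φ m.succ).1).card = p m)
    (hmix : ∀ m₀, m₀ ∉ L →
      ((n m₀).Prime ∧ ∀ m : Fin r, (m ∈ L ∨ (m ∉ L ∧ m < m₀)) → n m < n m₀) ∨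
      (∀ s t s' t' : Kf (is m₀) →+* ℂ, s.comp (im m₀) = τ → t.comp (im m₀) = τ → s'.comp (im m₀) = τ → t'.comp (im m₀) = τ → s ≠ t → s' ≠ t' →
        ∃ ρ : ℂ ≃+* ℂ, (∀ m : Fin r, (m ∈ L ∨ (m ∉ L ∧ m < m₀)) → ∀ u : Kf (is m) →+* ℂ, u.comp (im m) = τ → (ρ : ℂ →+* ℂ).comp u = u) ∧
          (ρ : ℂ →+* ℂ).comp s = s' ∧ (ρ : ℂ →+* ℂ).comp t = t'))
    {X : AbelianVariety ℂ} (hX : Domination.AVDominatedBy X (⨁ fun j => A (κ j))) : HodgeConjectureFor X.dim X.X :=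
  Domination.hodgeConjectureFor_of_avDominatedBy
    (hodgeConjectureFor_biproduct_comp_of_mixedTower_markman hW4 hM6 n p L hnp hcop hp1 κ h2 hdeg im hA hΨ hp hmix) hX

end Headline

end Summit.HodgeConjecture.CorCM.MultiFieldWeil

end
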